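import Summits.Ventures.YMGap.RobustBall.CentreTwist
import Summits.Ventures.YMGap.RobustBall.FiniteGibbsAverages
import Literature.MathematicalPhysics.QuantumFieldTheory.QuasiLocalGaugePerturbationKernels
import HarnessLib

/-!
# RobustBall/CentreProjection — the centre-projection bound (Fröhlich 1979 / Mack–Petkova 1979):
# for a LINKWISE centre-blind perturbation the `SU(N)` Wilson loop is dominated by the Wilson loop of
# the induced inhomogeneous `ℤ_N` gauge theory, uniformly in the background

HONEST FRAMING: venture file of the cell `pub-ymgap` (QuantumFields programme), track Y2 ROBUST-BALL, seat
ds-4 g7 (lead R222, rb-theory §6(c) names of record).  WHAT THIS IS: an INEQUALITY BETWEEN LATTICE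
EXPECTATIONS on a finite torus («centre dominance»): for every `N ≥ 1`, `d`, torus `L`, tree coupling `β`
and every perturbation `W` of the Wilson action that is LINKWISE centre-blind (`IsCentreBlind`, no
smallness / range / window asked of `W`),
`|⟨(1/N) Re tr U_{∂R×T}⟩_{β,W,L}| ≤ sup_U ‖⟨ψ(∮_{∂R×T} k)⟩^{ℤ_N}_{β,U}‖`,
where the right side is the Wilson loop of the INHOMOGENEOUS `ℤ_N` lattice gauge theory
`k : links → ℤ/N` with plaquette weights `exp(β Re(ψ((curl k)_p) tr U_p))` in the background `U`
(`znLoop`).  No confinement / area-law claim is made in this file: the `ℤ_N` input is supplied BY NAME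
downstream (`ZNGaugeLayer`, `ZNGaugePeeling`).  Nothing about the continuum limit or a Clay-sense mass gap.

Mechanism (as printed: J. Fröhlich, Phys. Lett. B 83 (1979) 195; G. Mack, V. B. Petkova, Ann. Phys.
123 (1979) 442, §2): product Haar measure is invariant under `U ↦ ζ·U` for every FIXED centre-valued
`ζ`; averaging the numerator and the normaliser of `⟨W_C⟩_{β,W}` over the finite group of twists
`ζ_k = (ψ(k_e)·1)_e`, `k : links → ℤ/N`, and using `W(ζ_k U) = W(U)` (centre-blindness),
`S(ζ_k U) = N·#plaquettes − ∑_p Re(ψ((curl k)_p) tr U_p)` and `tr(ζ_k U)_C = ψ(∮_C k) tr U_C`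
(`CentreTwist`) turns both into integrals of the SAME positive density `G(U) ∝ e^{−W(U)} Z^{ℤ_N}_U`
against `loopTrace · znLoop` resp. `1`, whence the bound (`abs_expectation_wilsonLoop_le_of_isTwistBlind`; the
hypothesis actually used is invariance under the concrete twists `ψ(k_e)·1`, `IsTwistBlind`, implied by rb-theory's
`IsCentreBlind`: `abs_expectation_wilsonLoop_le_of_isCentreBlind`).
-/

noncomputable section

open MeasureTheory Finset
open Literature.MathematicalPhysics.QuantumLattice (fundamentalRep fundamentalRep_apply continuous_fundamentalRep)
open Literature.MathematicalPhysics.QuantumFieldTheory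

namespace Summit.Ventures.YMGap.RobustBall

variable {d L N : ℕ} [NeZero L] [NeZero N]

/-! ### The induced inhomogeneous `ℤ_N` gauge theory of a background `U` -/

/-- The `ℤ_N` plaquette energy of the twist `k` in the background `U`: `∑_p Re(ψ((curl k)_p) · tr U_p)`. [folklore] -/
def twistEnergy (k : Edge d L → ZMod N) (U : GaugeConfig d L (SUN N)) : ℝ :=
  ∑ p : Plaquette d L, (ψ N (plaqSum k p.1 p.2.1.1 p.2.1.2) *
    ((plaquetteHolonomy U p.1 p.2.1.1 p.2.1.2 : SUN N) : Matrix (Fin N) (Fin N) ℂ).trace).re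

/-- The Boltzmann weight `exp(β · twistEnergy k U)` of the induced `ℤ_N` gauge theory in the background `U`
(INHOMOGENEOUS: one complex coupling `β tr U_p`, `|tr U_p| ≤ N`, per plaquette). [folklore] -/
def znWeight (β : ℝ) (U : GaugeConfig d L (SUN N)) (k : Edge d L → ZMod N) : ℝ :=
  Real.exp (β * twistEnergy k U)

/-- **The `ℤ_N` Wilson loop of the induced theory**: `⟨ψ(∮_{∂R×T} k)⟩` under the weights `znWeight β U`. [folklore] -/
def znLoop (β : ℝ) (U : GaugeConfig d L (SUN N)) (x : Site d L) (i j : Fin d) (R T : ℕ) : ℂ :=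
  FiniteGibbs.cavg (znWeight β U) fun k => ψ N (loopSum k x i j R T)

/-- The `ℤ_N` weights are positive. [folklore] -/
theorem znWeight_pos (β : ℝ) (U : GaugeConfig d L (SUN N)) (k : Edge d L → ZMod N) : 0 < znWeight β U k :=
  Real.exp_pos _

/-- The `ℤ_N` partition function is positive. [folklore] -/
theorem mass_znWeight_pos (β : ℝ) (U : GaugeConfig d L (SUN N)) : 0 < FiniteGibbs.mass (znWeight β U) :=
  FiniteGibbs.mass_pos_of_pos (znWeight_pos β U)

/-- `‖znLoop‖ ≤ 1` always (so every bound below may assume `M ≤ 1` without loss). [folklore] -/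
theorem norm_znLoop_le_one (β : ℝ) (U : GaugeConfig d L (SUN N)) (x : Site d L) (i j : Fin d) (R T : ℕ) :
    ‖znLoop β U x i j R T‖ ≤ 1 :=
  FiniteGibbs.norm_cavg_le (fun k => (znWeight_pos β U k).le) (mass_znWeight_pos β U) fun _ => (norm_ψ _).le

/-- **The Wilson action of a twisted configuration, `ℤ_N` form**: `S(ζ_k U) = N·#plaquettes − twistEnergy k U`. [folklore] -/
theorem wilsonAction_twist_eq (k : Edge d L → ZMod N) (U : GaugeConfig d L (SUN N)) :
    wilsonAction (fundamentalRep (Fin N)) (twistOf k * U) =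
      (N : ℝ) * Fintype.card (Plaquette d L) - twistEnergy k U := by
  rw [wilsonAction_twist, Finset.sum_sub_distrib, Finset.sum_const, Finset.card_univ, nsmul_eq_mul, mul_comm]
  rfl

/-! ### Twist-blind perturbations (the hypothesis actually used) -/

/-- **`IsTwistBlind W`**: the total perturbation is invariant under the LINKWISE twists by the concrete central
elements `centreOf (k e) = ψ(k e)·1`, `k : links → ℤ/N` — the hypothesis the centre-projection bound actually uses.
rb-theory's `IsCentreBlind` (invariance under every centre-valued `ζ`) implies it (`IsCentreBlind.isTwistBlind`);
for membership proofs it is the convenient form (no «centre = scalars» needed): every plaquette action through a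
function `f` with `f (centreOf a * g) = f g` is twist-blind (`isTwistBlind_of_plaquetteAction`), e.g. the adjoint
density `|tr g|²` at ANY coupling (`normSq_trace_centreOf_mul`). [folklore] -/
def IsTwistBlind (W : Perturbation d L N) : Prop :=
  ∀ (k : Edge d L → ZMod N) (U : GaugeConfig d L (SUN N)), W.total (twistOf k * U) = W.total U

/-- Centre-blind (rb-theory's reserved predicate) implies twist-blind. [folklore] -/
theorem IsCentreBlind.isTwistBlind {W : Perturbation d L N} (h : IsCentreBlind W) : IsTwistBlind W :=
  fun k U => h (twistOf k) (twistOf_mem_center k) U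

/-- The zero perturbation is twist-blind. [folklore] -/
theorem isTwistBlind_zero : IsTwistBlind (0 : Perturbation d L N) := fun _ _ => by simp

/-- **Plaquette actions through twist-invariant densities are twist-blind**: `W.total U = ∑_q f(U_q)` with
`f (centreOf a * g) = f g` (e.g. `f = β_A |tr|²`, any `β_A`). [folklore] -/
theorem isTwistBlind_of_plaquetteAction {W : Perturbation d L N} {f : SUN N → ℝ} (hW : IsPlaquetteAction f W)
    (hf : ∀ (a : ZMod N) (g : SUN N), f (centreOf a * g) = f g) : IsTwistBlind W := fun k U => by
  rw [hW, hW]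
  refine Finset.sum_congr rfl fun q _ => ?_
  rw [plaquetteHolonomy_mul_of_center _ _ (twistOf_mem_center k), plaquetteHolonomy_twistOf, hf]

/-! ### Product Haar measure is invariant under centre twists -/

/-- The centre twist `U ↦ ζ_k · U` as a measurable equivalence of torus configurations. [folklore] -/
def twistEquiv (k : Edge d L → ZMod N) : GaugeConfig d L (SUN N) ≃ᵐ GaugeConfig d L (SUN N) :=
  MeasurableEquiv.piCongrRight fun e => MeasurableEquiv.mulLeft (twistOf k e)

omit [NeZero L] in
/-- `twistEquiv k U = twistOf k * U`. [folklore] -/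
theorem twistEquiv_apply (k : Edge d L → ZMod N) (U : GaugeConfig d L (SUN N)) :
    twistEquiv k U = twistOf k * U := rfl

/-- **Left invariance of product Haar under a fixed centre twist.** [folklore] -/
theorem measurePreserving_twistEquiv (k : Edge d L → ZMod N) :
    MeasurePreserving (twistEquiv k) (Measure.pi fun _ : Edge d L => haarProbability (SUN N))
      (Measure.pi fun _ : Edge d L => haarProbability (SUN N)) :=
  measurePreserving_pi _ _ fun e => measurePreserving_mul_left (haarProbability (SUN N)) (twistOf k e)

/-! ### Continuity of the complex Wilson loop -/

omit [NeZero L] [NeZero N] in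
/-- Line holonomies depend continuously on the configuration. [folklore] -/
theorem continuous_lineHolonomy (i : Fin d) :
    ∀ (n : ℕ) (y : Site d L), Continuous fun U : GaugeConfig d L (SUN N) => lineHolonomy U i n y
  | 0, y => by simp only [lineHolonomy]; exact continuous_const
  | n + 1, y => by
      show Continuous fun U : GaugeConfig d L (SUN N) => U (y, i) * lineHolonomy U i n (y.shift i)
      exact (continuous_apply _).mul (continuous_lineHolonomy i n _)

omit [NeZero L] [NeZero N] in
/-- The complex Wilson loop depends continuously on the configuration. [folklore] -/
theorem continuous_loopTrace (x : Site d L) (i j : Fin d) (R T : ℕ) :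
    Continuous (loopTrace (N := N) x i j R T) := by
  unfold loopTrace rectangleHolonomy
  refine continuous_const.mul (Continuous.matrix_trace (continuous_subtype_val.comp ?_))
  exact (((continuous_lineHolonomy i R x).mul (continuous_lineHolonomy j T _)).mul
    (continuous_lineHolonomy i R _).inv).mul (continuous_lineHolonomy j T x).inv

/-! ### The averaging identity and the centre-projection bound -/

/-- Averaging an integral against product Haar over all centre twists `k : links → ℤ/N`. [folklore] -/
theorem integral_eq_avg_twist {E : Type*} [NormedAddCommGroup E] [NormedSpace ℝ E] [CompleteSpace E]
    (g : GaugeConfig d L (SUN N) → E)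
    (hg : ∀ k : Edge d L → ZMod N, Integrable (fun U => g (twistOf k * U))
      (Measure.pi fun _ : Edge d L => haarProbability (SUN N))) :
    ∫ U, g U ∂(Measure.pi fun _ : Edge d L => haarProbability (SUN N)) =
      ∫ U, (Fintype.card (Edge d L → ZMod N) : ℝ)⁻¹ • ∑ k : Edge d L → ZMod N, g (twistOf k * U)
        ∂(Measure.pi fun _ : Edge d L => haarProbability (SUN N)) := by
  set π := Measure.pi fun _ : Edge d L => haarProbability (SUN N) with hπ
  have hk : ∀ k : Edge d L → ZMod N, ∫ U, g (twistOf k * U) ∂π = ∫ U, g U ∂π := fun k =>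
    (measurePreserving_twistEquiv k).integral_comp' (f := twistEquiv k) g
  rw [integral_smul, integral_finsetSum _ fun k _ => hg k]
  simp only [hk, Finset.sum_const, Finset.card_univ]
  rw [← Nat.cast_smul_eq_nsmul ℝ, smul_smul, inv_mul_cancel₀ (by positivity), one_smul]

/-- **THE CENTRE-PROJECTION BOUND** (Fröhlich 1979; Mack–Petkova 1979, §2 — centre dominance as an
inequality between lattice expectations).  For EVERY linkwise centre-blind perturbation `W` of the `SU(N)`
Wilson action (no smallness, range or window hypothesis) and every uniform bound `M` on the Wilson loop of the
induced inhomogeneous `ℤ_N` gauge theory over all backgrounds `U`,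
`|⟨(1/N) Re tr U_{∂R×T}⟩_{β,W,L}| ≤ M`.  HONEST LABEL: no area law is asserted here — the `ℤ_N` input `M` is
supplied by name downstream. [cite: Frohlich1979ZN, Eq. (7)–(9)] -/
theorem abs_expectation_wilsonLoop_le_of_isTwistBlind (W : Perturbation d L N) (hW : IsTwistBlind W)
    (β : ℝ) (x : Site d L) (i j : Fin d) (R T : ℕ) {M : ℝ}
    (hM : ∀ U : GaugeConfig d L (SUN N), ‖znLoop β U x i j R T‖ ≤ M) :
    |W.expectation (fundamentalRep (Fin N)) β (wilsonLoop (fundamentalRep (Fin N)) x i j R T)| ≤ M := by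
  set ρ := fundamentalRep (Fin N) with hρdef
  have hρ : Continuous ρ := continuous_fundamentalRep (Fin N)
  set π : Measure (GaugeConfig d L (SUN N)) := Measure.pi fun _ : Edge d L => haarProbability (SUN N) with hπ
  haveI : IsProbabilityMeasure π := by rw [hπ]; infer_instance
  set E : GaugeConfig d L (SUN N) → ℝ := fun U => -β * wilsonAction ρ U - W.total U with hE
  -- measurability / boundedness of the energy
  have hEm : Measurable E := QuasiLocalGaugePerturbation.measurable_action ρ hρ β W
  obtain ⟨CE, hCE⟩ := QuasiLocalGaugePerturbation.exists_abs_action_le ρ hρ β W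
  have hexp_m : Measurable fun U => Real.exp (E U) := Real.measurable_exp.comp hEm
  have hexp_bd : ∀ U, ‖Real.exp (E U)‖ ≤ Real.exp CE := fun U => by
    rw [Real.norm_eq_abs, abs_of_pos (Real.exp_pos _)]; exact Real.exp_le_exp.2 (le_of_abs_le (hCE U))
  have hexp_int : Integrable (fun U => Real.exp (E U)) π :=
    Integrable.of_bound hexp_m.aestronglyMeasurable (Real.exp CE) (Filter.Eventually.of_forall hexp_bd)
  have hZpos : 0 < ∫ U, Real.exp (E U) ∂π := integral_exp_pos hexp_int
  -- the complex integrand `g₁ = e^{E} · loopTrace`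
  set lt := loopTrace (N := N) x i j R T with hlt
  have hlt_m : Measurable lt := (continuous_loopTrace x i j R T).measurable
  set g₁ : GaugeConfig d L (SUN N) → ℂ := fun U => (Real.exp (E U) : ℂ) * lt U with hg₁
  -- Step 1: the expectation as a tilted integral
  have hexp_eq : W.expectation ρ β (wilsonLoop ρ x i j R T) =
      (∫ U, Real.exp (E U) * wilsonLoop ρ x i j R T U ∂π) / ∫ U, Real.exp (E U) ∂π := by
    rw [QuasiLocalGaugePerturbation.expectation, QuasiLocalGaugePerturbation.perturbedMeasure_eq_tilted ρ hρ β W,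
      ← hπ, integral_tilted]
    simp only [smul_eq_mul]
    rw [← integral_div]
    exact integral_congr_ae (Filter.Eventually.of_forall fun U => by ring)
  -- Step 2: real part of the complex integral
  have hg₁_int : Integrable g₁ π := by
    refine Integrable.of_bound ((Complex.measurable_ofReal.comp hexp_m).mul hlt_m).aestronglyMeasurable
      (Real.exp CE) (Filter.Eventually.of_forall fun U => ?_)
    rw [hg₁]; dsimp only
    rw [norm_mul, Complex.norm_real]
    calc ‖Real.exp (E U)‖ * ‖lt U‖ ≤ Real.exp CE * 1 :=
          mul_le_mul (hexp_bd U) (norm_loopTrace_le_one x i j R T U) (norm_nonneg _) (Real.exp_pos _).le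
      _ = Real.exp CE := mul_one _
  have hre : ∫ U, Real.exp (E U) * wilsonLoop ρ x i j R T U ∂π = (∫ U, g₁ U ∂π).re := by
    have h := integral_re hg₁_int
    simp only [RCLike.re_to_complex] at h
    rw [← h]
    refine integral_congr_ae (Filter.Eventually.of_forall fun U => ?_)
    show Real.exp (E U) * wilsonLoop ρ x i j R T U = ((Real.exp (E U) : ℂ) * lt U).re
    rw [Complex.re_ofReal_mul, hlt, wilsonLoop_eq_re_loopTrace]
  -- Step 3: twisted integrands
  set P := Fintype.card (Plaquette d L) with hP
  set K := Fintype.card (Edge d L → ZMod N) with hK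
  have hK0 : (0 : ℝ) < K := by rw [hK]; exact_mod_cast Fintype.card_pos
  have hEtwist : ∀ (k : Edge d L → ZMod N) (U : GaugeConfig d L (SUN N)),
      E (twistOf k * U) = (-β * ((N : ℝ) * P) - W.total U) + β * twistEnergy k U := by
    intro k U
    simp only [hE]
    rw [wilsonAction_twist_eq, hW k U]
    ring
  -- the common positive density `G`
  set G : GaugeConfig d L (SUN N) → ℝ := fun U =>
    (K : ℝ)⁻¹ * (Real.exp (-β * ((N : ℝ) * P) - W.total U) * FiniteGibbs.mass (znWeight β U)) with hG
  have hG0 : ∀ U, 0 ≤ G U := fun U =>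
    mul_nonneg (inv_nonneg.2 hK0.le) (mul_nonneg (Real.exp_pos _).le (mass_znWeight_pos β U).le)
  have hsum₀ : ∀ U, (K : ℝ)⁻¹ • ∑ k : Edge d L → ZMod N, Real.exp (E (twistOf k * U)) = G U := by
    intro U
    simp only [hEtwist, Real.exp_add, ← Finset.mul_sum, smul_eq_mul, hG, FiniteGibbs.mass, znWeight]
  have hsum₁ : ∀ U, (K : ℝ)⁻¹ • ∑ k : Edge d L → ZMod N, g₁ (twistOf k * U) =
      (G U : ℂ) * (lt U * znLoop β U x i j R T) := by
    intro U
    have hm : (FiniteGibbs.mass (znWeight β U) : ℂ) ≠ 0 := by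
      rw [Ne, Complex.ofReal_eq_zero]; exact (mass_znWeight_pos β U).ne'
    simp only [hg₁, hlt, loopTrace_twist, hEtwist, Real.exp_add, Complex.ofReal_mul]
    have hfac : ∑ k : Edge d L → ZMod N, (Real.exp (-β * ((N : ℝ) * P) - W.total U) : ℂ) *
        (Real.exp (β * twistEnergy k U) : ℂ) * (ψ N (loopSum k x i j R T) * loopTrace x i j R T U) =
        (Real.exp (-β * ((N : ℝ) * P) - W.total U) : ℂ) * loopTrace x i j R T U *
          ∑ k : Edge d L → ZMod N, (znWeight β U k : ℂ) * ψ N (loopSum k x i j R T) := by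
      rw [Finset.mul_sum]
      refine Finset.sum_congr rfl fun k _ => ?_
      rw [znWeight]; ring
    rw [hfac, znLoop, FiniteGibbs.cavg, hG, Complex.real_smul]
    push_cast
    field_simp
  -- Step 4: the two averaged integrals
  have hZ : ∫ U, Real.exp (E U) ∂π = ∫ U, G U ∂π := by
    rw [integral_eq_avg_twist (fun U => Real.exp (E U)) fun k => ?_]
    · exact integral_congr_ae (Filter.Eventually.of_forall hsum₀)
    · exact (measurePreserving_twistEquiv k).integrable_comp_emb (twistEquiv k).measurableEmbedding |>.2 hexp_int
  have hN₁ : ∫ U, g₁ U ∂π = ∫ U, (G U : ℂ) * (lt U * znLoop β U x i j R T) ∂π := by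
    rw [integral_eq_avg_twist g₁ fun k => ?_]
    · exact integral_congr_ae (Filter.Eventually.of_forall hsum₁)
    · exact (measurePreserving_twistEquiv k).integrable_comp_emb (twistEquiv k).measurableEmbedding |>.2 hg₁_int
  -- Step 5: the norm bound
  have hGint : Integrable G π := by
    have h1 : Integrable (fun U => ∑ k : Edge d L → ZMod N, Real.exp (E (twistOf k * U))) π :=
      integrable_finsetSum Finset.univ fun k _ =>
        (measurePreserving_twistEquiv k).integrable_comp_emb (twistEquiv k).measurableEmbedding |>.2 hexp_int
    refine (integrable_congr (Filter.Eventually.of_forall fun U => ?_)).1 (h1.smul ((K : ℝ)⁻¹))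
    show (K : ℝ)⁻¹ • ∑ k : Edge d L → ZMod N, Real.exp (E (twistOf k * U)) = G U
    exact hsum₀ U
  have hbound : ‖∫ U, g₁ U ∂π‖ ≤ M * ∫ U, Real.exp (E U) ∂π := by
    rw [hN₁, hZ, ← integral_const_mul]
    refine (norm_integral_le_integral_norm _).trans (integral_mono_of_nonneg
      (Filter.Eventually.of_forall fun U => norm_nonneg _) (hGint.const_mul M)
      (Filter.Eventually.of_forall fun U => ?_))
    show ‖(G U : ℂ) * (lt U * znLoop β U x i j R T)‖ ≤ M * G U
    rw [norm_mul, Complex.norm_real, Real.norm_eq_abs, abs_of_nonneg (hG0 U), norm_mul, mul_comm]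
    refine mul_le_mul_of_nonneg_right ?_ (hG0 U)
    calc ‖lt U‖ * ‖znLoop β U x i j R T‖ ≤ 1 * M :=
          mul_le_mul (norm_loopTrace_le_one x i j R T U) (hM U) (norm_nonneg _) zero_le_one
      _ = M := one_mul M
  -- Step 6: conclude
  rw [hexp_eq, hre, abs_div, abs_of_pos hZpos, div_le_iff₀ hZpos]
  exact (Complex.abs_re_le_norm _).trans hbound

/-- **THE CENTRE-PROJECTION BOUND for rb-theory's reserved class `IsCentreBlind`** (ROBUST-BALL-STATEMENT §6(c)):
every LINKWISE centre-blind perturbation, of any size and range, has its `SU(N)` Wilson loop dominated by any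
uniform bound on the induced `ℤ_N` Wilson loops.  HONEST LABEL: an inequality between lattice expectations; the
`ℤ_N` bound is supplied by name downstream. [cite: Frohlich1979ZN, Eq. (7)–(9)] -/
theorem abs_expectation_wilsonLoop_le_of_isCentreBlind (W : Perturbation d L N) (hW : IsCentreBlind W)
    (β : ℝ) (x : Site d L) (i j : Fin d) (R T : ℕ) {M : ℝ}
    (hM : ∀ U : GaugeConfig d L (SUN N), ‖znLoop β U x i j R T‖ ≤ M) :
    |W.expectation (fundamentalRep (Fin N)) β (wilsonLoop (fundamentalRep (Fin N)) x i j R T)| ≤ M :=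
  abs_expectation_wilsonLoop_le_of_isTwistBlind W hW.isTwistBlind β x i j R T hM

end Summit.Ventures.YMGap.RobustBall

end
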